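import Summits.KontsevichZagierPeriods.KontsevichZagierPeriods.Theses.SymplecticScissors

/-!
# `PlanarCompiler` (crux stmt-KontsevichZagierPeriods-10058, route SymplecticScissors) — lead skeleton

Line `twist-restoring-shear` (crux protocol, lead prover), reshaped at L1 with the SAME composition
idea (Θ = cell compiler; normal form; Θ kills 1a/1b/2; Green by the inverse-function-theorem engine on
sign cells): the twist parameter is fixed to `λ = 0` and flat cells (`∂_bA = 0`) are a third cell type
that needs no transport, which removes the "generic λ" step of the planner's `stub_genericShear`;
the planner's `stub_greenSignedBands` is split into `stub_signedSweep` (geometry), `stub_band` (one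
cell) and `stub_greenAssembly` (bookkeeping, held by the lead). `PlanarCompiler_of` below composes the
seven stubs and concludes the crux BY NAME; the only `sorry`s are the `stub_*` theorems.

Conventions: `G` = the planar set-chain group
`closure((domainAddRel ∪ changeOfVariablesRel) ∩ closure{[s] : s planar, integrand 1})`, written out
in every signature (registered stubs carry no local definitions); `Δ` the closed and `T` the open
standard triangle; `Ψ₁ = fun p => ![p 0, A p]`, `Ψ₂ = fun p => ![p 1, B p]`.
-/

noncomputable section

open MeasureTheory Set
open Literature.NumberTheory.Transcendental Literature.ModelTheory.ExponentialFields
open Summit.KontsevichZagierPeriods.KontsevichZagierPeriods.Theses.SymplecticScissors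

namespace Summit.KontsevichZagierPeriods.SymplecticScissors.PlanarCompilerProof

/-- **Stub 1 (M).** The cell compiler `Θ`: the additive map on `FormalRep` sending a 1-dimensional representation `[∫_σ f]` to `[cell of f⁺] − [cell of f⁻]` (honest integrand-`1` planar representations under the graphs of `f` and `−f` over `σ`) and every other generator to `0` (`FreeAbelianGroup.lift`; semialgebraicity of the cells by Tarski–Seidenberg, finite area by Tonelli). -/
theorem stub_cellCompiler :
    ∃ Θ : KZ.FormalRep →+ KZ.FormalRep, ((∀ ρ : KZ.IntegralRep 1, ∃ s t : KZ.IntegralRep 2, s.domain = {p : Fin 2 → ℝ | (fun _ : Fin 1 => p 0) ∈ ρ.domain ∧ 0 < p 1 ∧ p 1 < ρ.integrand (fun _ : Fin 1 => p 0)} ∧ t.domain = {p : Fin 2 → ℝ | (fun _ : Fin 1 => p 0) ∈ ρ.domain ∧ 0 < p 1 ∧ p 1 < -ρ.integrand (fun _ : Fin 1 => p 0)} ∧ (∀ p ∈ s.domain, s.integrand p = 1) ∧ (∀ p ∈ t.domain, t.integrand p = 1) ∧ Θ (KZ.of ρ) = KZ.of s - KZ.of t) ∧ (∀ (n : ℕ)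 (ρ : KZ.IntegralRep n), n ≠ 1 → Θ (KZ.of ρ) = 0)) := by
  sorry

/-- **Stub 2 (L−).** Cylindrical normal form: every planar integrand-`1` representation is, modulo the planar set-chain group `G`, the `Θ`-image of a combination `c` of 1-dimensional representations with `eval c = area` (CAD of the domain; each band `{ξ_j < y < ξ_{j+1}}` is sheared onto the cell of `ξ_{j+1} − ξ_j`; graphs and the finitely many bad verticals are null). -/
theorem stub_normalForm :
    ∀ Θ : KZ.FormalRep →+ KZ.FormalRep, ((∀ ρ : KZ.IntegralRep 1, ∃ s t : KZ.IntegralRep 2, s.domain = {p : Fin 2 → ℝ | (fun _ : Fin 1 => p 0) ∈ ρ.domain ∧ 0 < p 1 ∧ p 1 < ρ.integrand (fun _ : Fin 1 => p 0)} ∧ t.domain = {p : Fin 2 → ℝ | (fun _ : Fin 1 => p 0) ∈ ρ.domain ∧ 0 < p 1 ∧ p 1 < -ρ.integrand (fun _ : Fin 1 => p 0)} ∧ (∀ p ∈ s.domain, s.integrand p = 1) ∧ (∀ p ∈ t.domain, t.integrand p = 1) ∧ Θ (KZ.of ρ) = KZ.of s - KZ.of t) ∧ (∀ (n : ℕ)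 (ρ : KZ.IntegralRep n), n ≠ 1 → Θ (KZ.of ρ) = 0)) → ∀ r : KZ.IntegralRep 2, (∀ p ∈ r.domain, r.integrand p = 1) → ∃ c : KZ.FormalRep, c ∈ AddSubgroup.closure (Set.range fun ρ : KZ.IntegralRep 1 => KZ.of ρ) ∧ KZ.eval c = r.value ∧ KZ.of r - Θ c ∈ AddSubgroup.closure ((KZ.domainAddRel ∪ KZ.changeOfVariablesRel) ∩ (AddSubgroup.closure {x : KZ.FormalRep | ∃ s : KZ.IntegralRep 2, (∀ p ∈ s.domain, s.integrand p = 1) ∧ x = KZ.of s} : Set KZ.FormalRep)) := by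
  sorry

/-- **Stub 3 (L).** `Θ` kills the elementary moves: every instance of 1a / 1b / 2 (any dimension; only dimension `1` matters, `Θ` vanishes elsewhere) is mapped into `G` (1a ↦ vertical cuts; 1b ↦ stacking shears after subdividing by the signs of `f, g, f+g`; rule 2 in dimension one ↦ the shear `(x,y) ↦ (Φ x, y/|Φ′ x|)` off the finitely many points where `Φ` is not `C²` or `Φ′ = 0`). -/
theorem stub_elementaryMoves :
    ∀ Θ : KZ.FormalRep →+ KZ.FormalRep, ((∀ ρ : KZ.IntegralRep 1, ∃ s t : KZ.IntegralRep 2, s.domain = {p : Fin 2 → ℝ | (fun _ : Fin 1 => p 0) ∈ ρ.domain ∧ 0 < p 1 ∧ p 1 < ρ.integrand (fun _ : Fin 1 => p 0)} ∧ t.domain = {p : Fin 2 → ℝ | (fun _ : Fin 1 => p 0) ∈ ρ.domain ∧ 0 < p 1 ∧ p 1 < -ρ.integrand (fun _ : Fin 1 => p 0)} ∧ (∀ p ∈ s.domain, s.integrand p = 1) ∧ (∀ p ∈ t.domain, t.integrand p = 1) ∧ Θ (KZ.of ρ) = KZ.of s - KZ.of t) ∧ (∀ (n : ℕ) (ρ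 : KZ.IntegralRep n), n ≠ 1 → Θ (KZ.of ρ) = 0)) → ∀ x ∈ KZ.domainAddRel ∪ KZ.integrandAddRel ∪ KZ.changeOfVariablesRel, Θ x ∈ AddSubgroup.closure ((KZ.domainAddRel ∪ KZ.changeOfVariablesRel) ∩ (AddSubgroup.closure {x : KZ.FormalRep | ∃ s : KZ.IntegralRep 2, (∀ p ∈ s.domain, s.integrand p = 1) ∧ x = KZ.of s} : Set KZ.FormalRep)) := by
  sorry

/-- **Stub 4 (M, the lever; = route support EqualJacobianTransport specialised).** On an open `ℚ`-semialgebraic `U` where `A, B` are `C¹` with `∂_bA = ∂_aB ≠ 0` and both Lagrangian projections `Ψ₁ = (a, A)`, `Ψ₂ = (b, B)` injective, `[Ψ₁ U] − [Ψ₂ U]` is ONE change-of-variables instance (`Φ = Ψ₂ ∘ Ψ₁⁻¹`, inverse function theorem, `|det DΦ| = |∂_aB| / |∂_bA| = 1`). -/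
theorem stub_shearedTransport :
    ∀ (U : Set (Fin 2 → ℝ)) (A B : (Fin 2 → ℝ) → ℝ), IsOpen U → IsSemialgebraic ℚ U → IsSemialgebraicFunOn ℚ U A → IsSemialgebraicFunOn ℚ U B → ContDiffOn ℝ 1 A U → ContDiffOn ℝ 1 B U → (∀ p ∈ U, fderiv ℝ A p (Pi.single 1 1) = fderiv ℝ B p (Pi.single 0 1)) → (∀ p ∈ U, fderiv ℝ A p (Pi.single 1 1) ≠ 0) → Set.InjOn (fun p : Fin 2 → ℝ => (![p 0, A p] : Fin 2 → ℝ)) U → Set.InjOn (fun p : Fin 2 → ℝ => (![p 1, B p] : Fin 2 → ℝ)) U → ∀ r r' : KZ.IntegralRep 2, r.domain = (fun p : Fin 2 → ℝ => (![p 0, A p] : Fin 2 → ℝ)) '' U → r'.domain = (fun p : Fin 2 → ℝ => (![p 1, B p] : Fin 2 → ℝ)) '' U → (∀ q ∈ r.domain, r.integrand q = 1) → (∀ q ∈ r'.domain, r'.integrand q = 1) → KZ.of r - KZ.of r' ∈ KZ.changeOfVariablesRel := by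
  sorry

/-- **Stub 5 (L).** The signed vertical sweep of the open triangle: a cylindrical decomposition into strips `(x_j, x_{j+1})` and stacked cells `{lo < b < hi}` with continuous, monotone, `ℚ`-semialgebraic graph functions (`lo = 0` at the bottom, `hi = 1 − a` at the top, consecutive cells share their graph), each cell inside the common `C¹`-locus of `A, B` (generic smoothness), carrying the constant sign `ε ∈ {1, −1, 0}` of `∂_bA` (`= ∂_aB`, Clairaut from the potential `S`), with both sheared projections injective on the signed cells (bi-convexity + strict fibre monotonicity), together with the trace representations `[∫ A(t, lo t) dt]`, `[∫ A(t, hi t) dt]` and the integrand-`1` representations on `Ψ₁(C)`, `Ψ₂(C)`. Pure semialgebraic geometry: no `Θ`. -/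
theorem stub_signedSweep :
    ∀ (A B S : (Fin 2 → ℝ) → ℝ), IsSemialgebraicFunOn ℚ {p : Fin 2 → ℝ | 0 ≤ p 0 ∧ 0 ≤ p 1 ∧ p 0 + p 1 ≤ 1} A → IsSemialgebraicFunOn ℚ {p : Fin 2 → ℝ | 0 ≤ p 0 ∧ 0 ≤ p 1 ∧ p 0 + p 1 ≤ 1} B → ContinuousOn A {p : Fin 2 → ℝ | 0 ≤ p 0 ∧ 0 ≤ p 1 ∧ p 0 + p 1 ≤ 1} → ContinuousOn B {p : Fin 2 → ℝ | 0 ≤ p 0 ∧ 0 ≤ p 1 ∧ p 0 + p 1 ≤ 1} → (∀ p : Fin 2 → ℝ, 0 < p 0 → 0 < p 1 → p 0 + p 1 < 1 → HasFDerivAt S (A p • (ContinuousLinearMap.proj 0 : (Fin 2 → ℝ) →L[ℝ] ℝ) + B p • (ContinuousLinearMap.proj 1 : (Fin 2 → ℝ) →L[ℝ] ℝ)) p) → ∃ (k : ℕ) (x : Fin (k + 1) → ℝ) (m : ℕ) (str : Fin m → Fin k) (lev : Fin m → ℕ) (L : Fin k → ℕ) (lo hi : Fin m → ℝ → ℝ)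 (ε : Fin m → ℤ) (C : Fin m → Set (Fin 2 → ℝ)) (ρlo ρhi : Fin m → KZ.IntegralRep 1) (r₁ r₂ : Fin m → KZ.IntegralRep 2), StrictMono x ∧ x 0 = 0 ∧ x (Fin.last k) = 1 ∧ (∀ i, lev i < L (str i)) ∧ (∀ i j, str i = str j → lev i = lev j → i = j) ∧ (∀ (j : Fin k) (l : ℕ), l < L j → ∃ i, str i = j ∧ lev i = l) ∧ (∀ j, 0 < L j) ∧ (∀ i, lev i = 0 → ∀ t ∈ (Set.Icc (x (Fin.castSucc (str i))) (x (Fin.succ (str i)))), lo i t = 0) ∧ (∀ i, lev i + 1 = L (str i) → ∀ t ∈ (Set.Icc (x (Fin.castSucc (str i))) (x (Fin.succ (str i)))), hi i t = 1 - t) ∧ (∀ i j, str i = str j → lev j = lev i + 1 → ∀ t ∈ (Set.Icc (x (Fin.castSucc (str i))) (x (Fin.succ (str i)))), lo j t = hi i t) ∧ (∀ i, ContinuousOn (lo i) (Set.Icc (x (Fin.castSucc (str i))) (x (Fin.succ (str i))))) ∧ (∀ i, ContinuousOn (hi i) (Set.Icc (x (Fin.castSucc (str i))) (x (Fin.succ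 (str i))))) ∧ (∀ i, MonotoneOn (lo i) (Set.Icc (x (Fin.castSucc (str i))) (x (Fin.succ (str i)))) ∨ AntitoneOn (lo i) (Set.Icc (x (Fin.castSucc (str i))) (x (Fin.succ (str i))))) ∧ (∀ i, MonotoneOn (hi i) (Set.Icc (x (Fin.castSucc (str i))) (x (Fin.succ (str i)))) ∨ AntitoneOn (hi i) (Set.Icc (x (Fin.castSucc (str i))) (x (Fin.succ (str i))))) ∧ (∀ i, ∀ t ∈ (Set.Ioo (x (Fin.castSucc (str i))) (x (Fin.succ (str i)))), lo i t < hi i t) ∧ (∀ i, IsSemialgebraicFunOn ℚ {z : Fin 1 → ℝ | z 0 ∈ Set.Ioo (x (Fin.castSucc (str i))) (x (Fin.succ (str i)))} (fun z => lo i (z 0))) ∧ (∀ i, IsSemialgebraicFunOn ℚ {z : Fin 1 → ℝ | z 0 ∈ Set.Ioo (x (Fin.castSucc (str i))) (x (Fin.succ (str i)))} (fun z => hi i (z 0))) ∧ (∀ i, C i = {p : Fin 2 → ℝ | p 0 ∈ (Set.Ioo (x (Fin.castSucc (str i))) (x (Fin.succ (str i)))) ∧ lo i (p 0) < p 1 ∧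 p 1 < hi i (p 0)}) ∧ (∀ i, IsOpen (C i)) ∧ (∀ i, IsSemialgebraic ℚ (C i)) ∧ (∀ i, C i ⊆ {p : Fin 2 → ℝ | 0 < p 0 ∧ 0 < p 1 ∧ p 0 + p 1 < 1}) ∧ (Pairwise fun i j => Disjoint (C i) (C j)) ∧ MeasureTheory.volume ({p : Fin 2 → ℝ | 0 < p 0 ∧ 0 < p 1 ∧ p 0 + p 1 < 1} \ ⋃ i, C i) = 0 ∧ (∀ i, ContDiffOn ℝ 1 A (C i)) ∧ (∀ i, ContDiffOn ℝ 1 B (C i)) ∧ (∀ i, ∀ p ∈ C i, fderiv ℝ A p (Pi.single 1 1) = fderiv ℝ B p (Pi.single 0 1)) ∧ (∀ i, ε i = 1 ∨ ε i = -1 ∨ ε i = 0) ∧ (∀ i, ∀ p ∈ C i, ε i ≠ 0 → 0 < (ε i : ℝ) * fderiv ℝ A p (Pi.single 1 1)) ∧ (∀ i, ∀ p ∈ C i, ε i = 0 → fderiv ℝ A p (Pi.single 1 1) = 0) ∧ (∀ i, ε i ≠ 0 → Set.InjOn (fun p : Fin 2 → ℝ => (![p 0, A p] : Fin 2 → ℝ))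 (C i)) ∧ (∀ i, ε i ≠ 0 → Set.InjOn (fun p : Fin 2 → ℝ => (![p 1, B p] : Fin 2 → ℝ)) (C i)) ∧ (∀ i, (ρlo i).domain = {z : Fin 1 → ℝ | z 0 ∈ Set.Ioo (x (Fin.castSucc (str i))) (x (Fin.succ (str i)))}) ∧ (∀ i, (ρhi i).domain = {z : Fin 1 → ℝ | z 0 ∈ Set.Ioo (x (Fin.castSucc (str i))) (x (Fin.succ (str i)))}) ∧ (∀ i, ∀ z ∈ (ρlo i).domain, (ρlo i).integrand z = A ![z 0, lo i (z 0)]) ∧ (∀ i, ∀ z ∈ (ρhi i).domain, (ρhi i).integrand z = A ![z 0, hi i (z 0)]) ∧ (∀ i, (r₁ i).domain = (fun p : Fin 2 → ℝ => (![p 0, A p] : Fin 2 → ℝ)) '' C i) ∧ (∀ i, (r₂ i).domain = (fun p : Fin 2 → ℝ => (![p 1, B p] : Fin 2 → ℝ)) '' C i) ∧ (∀ i, (r₁ i).integrand = fun _ => 1) ∧ (∀ i, (r₂ i).integrand = fun _ => 1) := by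
  sorry

/-- **Stub 6 (M/L).** The band identity for ONE cell: if `y ↦ F(x, y)` is strictly increasing (`ε = 1`), strictly decreasing (`ε = −1`) or constant (`ε = 0`) on the fibres of the cell `C = {x ∈ (a,b), lo x < y < hi x}`, then `ε · [Ψ_F(C)] ≡ Θ[∫ F(t, hi t)] − Θ[∫ F(t, lo t)]` modulo `G` (`Ψ_F(C)` is the region between the two trace graphs; shear by the lower trace off finitely many verticals, then 1b under `Θ`). Stated for a general `F` so that it serves `A` and `B ∘ swap`. -/
theorem stub_band :
    ∀ Θ : KZ.FormalRep →+ KZ.FormalRep, ((∀ ρ : KZ.IntegralRep 1, ∃ s t : KZ.IntegralRep 2, s.domain = {p : Fin 2 → ℝ | (fun _ : Fin 1 => p 0) ∈ ρ.domain ∧ 0 < p 1 ∧ p 1 < ρ.integrand (fun _ : Fin 1 => p 0)} ∧ t.domain = {p : Fin 2 → ℝ | (fun _ : Fin 1 => p 0) ∈ ρ.domain ∧ 0 < p 1 ∧ p 1 < -ρ.integrand (fun _ : Fin 1 => p 0)} ∧ (∀ p ∈ s.domain, s.integrand p = 1) ∧ (∀ p ∈ t.domain, t.integrand p = 1) ∧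 Θ (KZ.of ρ) = KZ.of s - KZ.of t) ∧ (∀ (n : ℕ) (ρ : KZ.IntegralRep n), n ≠ 1 → Θ (KZ.of ρ) = 0)) → (∀ x ∈ KZ.domainAddRel ∪ KZ.integrandAddRel ∪ KZ.changeOfVariablesRel, Θ x ∈ AddSubgroup.closure ((KZ.domainAddRel ∪ KZ.changeOfVariablesRel) ∩ (AddSubgroup.closure {x : KZ.FormalRep | ∃ s : KZ.IntegralRep 2, (∀ p ∈ s.domain, s.integrand p = 1) ∧ x = KZ.of s} : Set KZ.FormalRep))) → ∀ (F : (Fin 2 → ℝ) → ℝ) (a b : ℝ) (lo hi : ℝ → ℝ) (ε : ℤ) (C : Set (Fin 2 → ℝ)), IsSemialgebraicFunOn ℚ {p : Fin 2 → ℝ | 0 ≤ p 0 ∧ 0 ≤ p 1 ∧ p 0 + p 1 ≤ 1} F → ContinuousOn F {p : Fin 2 → ℝ | 0 ≤ p 0 ∧ 0 ≤ p 1 ∧ p 0 + p 1 ≤ 1} → a < b → ContinuousOn lo (Set.Icc a b) → ContinuousOn hi (Set.Icc a b) → (∀ t ∈ Set.Ioo a b, lo t < hi t) → IsSemialgebraicFunOn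 ℚ {z : Fin 1 → ℝ | z 0 ∈ Set.Ioo a b} (fun z => lo (z 0)) → IsSemialgebraicFunOn ℚ {z : Fin 1 → ℝ | z 0 ∈ Set.Ioo a b} (fun z => hi (z 0)) → C = {p : Fin 2 → ℝ | p 0 ∈ Set.Ioo a b ∧ lo (p 0) < p 1 ∧ p 1 < hi (p 0)} → C ⊆ {p : Fin 2 → ℝ | 0 < p 0 ∧ 0 < p 1 ∧ p 0 + p 1 < 1} → IsSemialgebraic ℚ C → ContDiffOn ℝ 1 F C → (ε = 1 ∨ ε = -1 ∨ ε = 0) → (∀ p ∈ C, ε ≠ 0 → 0 < (ε : ℝ) * fderiv ℝ F p (Pi.single 1 1)) → (∀ p ∈ C, ε = 0 → fderiv ℝ F p (Pi.single 1 1) = 0) → ∀ (r : KZ.IntegralRep 2) (ρlo ρhi : KZ.IntegralRep 1), r.domain = (fun p : Fin 2 → ℝ => (![p 0, F p] : Fin 2 → ℝ)) '' C → (∀ q ∈ r.domain, r.integrand q = 1) → ρlo.domain = {z : Fin 1 → ℝ | z 0 ∈ Set.Ioo a b} → ρhi.domain = {z : Fin 1 → ℝ | z 0 ∈ Set.Ioo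 a b} → (∀ z ∈ ρlo.domain, ρlo.integrand z = F ![z 0, lo (z 0)]) → (∀ z ∈ ρhi.domain, ρhi.integrand z = F ![z 0, hi (z 0)]) → ε • KZ.of r - (Θ (KZ.of ρhi) - Θ (KZ.of ρlo)) ∈ AddSubgroup.closure ((KZ.domainAddRel ∪ KZ.changeOfVariablesRel) ∩ (AddSubgroup.closure {x : KZ.FormalRep | ∃ s : KZ.IntegralRep 2, (∀ p ∈ s.domain, s.integrand p = 1) ∧ x = KZ.of s} : Set KZ.FormalRep)) := by
  sorry

/-- **Stub 7 (L, lead).** Green bookkeeping: from the engine (stub 4), the band identity (stub 6) and two signed sweeps (stub 5 for `(A, B, S)` and for the swapped datum `(B∘swap, A∘swap, S∘swap)`), the `Θ`-image of the Green generator lies in `G`: per signed cell `ε([Ψ₁C] − [Ψ₂C]) ∈ G`; the `A`-sides telescope along the vertical sweep to `Θ[∫A(t,1−t)] − Θ[∫A(t,0)]`; the `B`-sides are redistributed (1a, common refinement, signs agree by Clairaut) onto the horizontal sweep where they telescope to `Θ[∫B(1−t,t)] − Θ[∫B(0,t)]`; 1b and `t ↦ 1 − t` finish. -/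
theorem stub_greenAssembly :
    ∀ Θ : KZ.FormalRep →+ KZ.FormalRep, ((∀ ρ : KZ.IntegralRep 1, ∃ s t : KZ.IntegralRep 2, s.domain = {p : Fin 2 → ℝ | (fun _ : Fin 1 => p 0) ∈ ρ.domain ∧ 0 < p 1 ∧ p 1 < ρ.integrand (fun _ : Fin 1 => p 0)} ∧ t.domain = {p : Fin 2 → ℝ | (fun _ : Fin 1 => p 0) ∈ ρ.domain ∧ 0 < p 1 ∧ p 1 < -ρ.integrand (fun _ : Fin 1 => p 0)} ∧ (∀ p ∈ s.domain, s.integrand p = 1) ∧ (∀ p ∈ t.domain, t.integrand p = 1) ∧ Θ (KZ.of ρ) = KZ.of s - KZ.of t) ∧ (∀ (n : ℕ) (ρ : KZ.IntegralRep n), n ≠ 1 → Θ (KZ.of ρ) = 0)) → (∀ x ∈ KZ.domainAddRel ∪ KZ.integrandAddRel ∪ KZ.changeOfVariablesRel, Θ x ∈ AddSubgroup.closure ((KZ.domainAddRel ∪ KZ.changeOfVariablesRel) ∩ (AddSubgroup.closure {x : KZ.FormalRep | ∃ s : KZ.IntegralRep 2, (∀ p ∈ s.domain, s.integrand p = 1)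 ∧ x = KZ.of s} : Set KZ.FormalRep))) → (∀ (U : Set (Fin 2 → ℝ)) (A B : (Fin 2 → ℝ) → ℝ), IsOpen U → IsSemialgebraic ℚ U → IsSemialgebraicFunOn ℚ U A → IsSemialgebraicFunOn ℚ U B → ContDiffOn ℝ 1 A U → ContDiffOn ℝ 1 B U → (∀ p ∈ U, fderiv ℝ A p (Pi.single 1 1) = fderiv ℝ B p (Pi.single 0 1)) → (∀ p ∈ U, fderiv ℝ A p (Pi.single 1 1) ≠ 0) → Set.InjOn (fun p : Fin 2 → ℝ => (![p 0, A p] : Fin 2 → ℝ)) U → Set.InjOn (fun p : Fin 2 → ℝ => (![p 1, B p] : Fin 2 → ℝ)) U → ∀ r r' : KZ.IntegralRep 2, r.domain = (fun p : Fin 2 → ℝ => (![p 0, A p] : Fin 2 → ℝ)) '' U → r'.domain = (fun p : Fin 2 → ℝ => (![p 1, B p] : Fin 2 → ℝ)) '' U → (∀ q ∈ r.domain, r.integrand q = 1) → (∀ q ∈ r'.domain, r'.integrand q = 1) → KZ.of r - KZ.of r' ∈ KZ.changeOfVariablesRel) → (∀ Θ : KZ.FormalRep →+ KZ.FormalRep,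 ((∀ ρ : KZ.IntegralRep 1, ∃ s t : KZ.IntegralRep 2, s.domain = {p : Fin 2 → ℝ | (fun _ : Fin 1 => p 0) ∈ ρ.domain ∧ 0 < p 1 ∧ p 1 < ρ.integrand (fun _ : Fin 1 => p 0)} ∧ t.domain = {p : Fin 2 → ℝ | (fun _ : Fin 1 => p 0) ∈ ρ.domain ∧ 0 < p 1 ∧ p 1 < -ρ.integrand (fun _ : Fin 1 => p 0)} ∧ (∀ p ∈ s.domain, s.integrand p = 1) ∧ (∀ p ∈ t.domain, t.integrand p = 1) ∧ Θ (KZ.of ρ) = KZ.of s - KZ.of t) ∧ (∀ (n : ℕ) (ρ : KZ.IntegralRep n), n ≠ 1 → Θ (KZ.of ρ) = 0)) → (∀ x ∈ KZ.domainAddRel ∪ KZ.integrandAddRel ∪ KZ.changeOfVariablesRel, Θ x ∈ AddSubgroup.closure ((KZ.domainAddRel ∪ KZ.changeOfVariablesRel) ∩ (AddSubgroup.closure {x : KZ.FormalRep | ∃ s : KZ.IntegralRep 2, (∀ p ∈ s.domain, s.integrand p = 1) ∧ x = KZ.of s} : Set KZ.FormalRep))) → ∀ (F : (Fin 2 → ℝ)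 → ℝ) (a b : ℝ) (lo hi : ℝ → ℝ) (ε : ℤ) (C : Set (Fin 2 → ℝ)), IsSemialgebraicFunOn ℚ {p : Fin 2 → ℝ | 0 ≤ p 0 ∧ 0 ≤ p 1 ∧ p 0 + p 1 ≤ 1} F → ContinuousOn F {p : Fin 2 → ℝ | 0 ≤ p 0 ∧ 0 ≤ p 1 ∧ p 0 + p 1 ≤ 1} → a < b → ContinuousOn lo (Set.Icc a b) → ContinuousOn hi (Set.Icc a b) → (∀ t ∈ Set.Ioo a b, lo t < hi t) → IsSemialgebraicFunOn ℚ {z : Fin 1 → ℝ | z 0 ∈ Set.Ioo a b} (fun z => lo (z 0)) → IsSemialgebraicFunOn ℚ {z : Fin 1 → ℝ | z 0 ∈ Set.Ioo a b} (fun z => hi (z 0)) → C = {p : Fin 2 → ℝ | p 0 ∈ Set.Ioo a b ∧ lo (p 0) < p 1 ∧ p 1 < hi (p 0)} → C ⊆ {p : Fin 2 → ℝ | 0 < p 0 ∧ 0 < p 1 ∧ p 0 + p 1 < 1} → IsSemialgebraic ℚ C → ContDiffOn ℝ 1 F C → (ε = 1 ∨ ε = -1 ∨ ε = 0) → (∀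 p ∈ C, ε ≠ 0 → 0 < (ε : ℝ) * fderiv ℝ F p (Pi.single 1 1)) → (∀ p ∈ C, ε = 0 → fderiv ℝ F p (Pi.single 1 1) = 0) → ∀ (r : KZ.IntegralRep 2) (ρlo ρhi : KZ.IntegralRep 1), r.domain = (fun p : Fin 2 → ℝ => (![p 0, F p] : Fin 2 → ℝ)) '' C → (∀ q ∈ r.domain, r.integrand q = 1) → ρlo.domain = {z : Fin 1 → ℝ | z 0 ∈ Set.Ioo a b} → ρhi.domain = {z : Fin 1 → ℝ | z 0 ∈ Set.Ioo a b} → (∀ z ∈ ρlo.domain, ρlo.integrand z = F ![z 0, lo (z 0)]) → (∀ z ∈ ρhi.domain, ρhi.integrand z = F ![z 0, hi (z 0)]) → ε • KZ.of r - (Θ (KZ.of ρhi) - Θ (KZ.of ρlo)) ∈ AddSubgroup.closure ((KZ.domainAddRel ∪ KZ.changeOfVariablesRel) ∩ (AddSubgroup.closure {x : KZ.FormalRep | ∃ s : KZ.IntegralRep 2, (∀ p ∈ s.domain, s.integrand p = 1) ∧ x = KZ.of s} : Set KZ.FormalRep))) → (∀ (A B S : (Fin 2 → ℝ) → ℝ),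 IsSemialgebraicFunOn ℚ {p : Fin 2 → ℝ | 0 ≤ p 0 ∧ 0 ≤ p 1 ∧ p 0 + p 1 ≤ 1} A → IsSemialgebraicFunOn ℚ {p : Fin 2 → ℝ | 0 ≤ p 0 ∧ 0 ≤ p 1 ∧ p 0 + p 1 ≤ 1} B → ContinuousOn A {p : Fin 2 → ℝ | 0 ≤ p 0 ∧ 0 ≤ p 1 ∧ p 0 + p 1 ≤ 1} → ContinuousOn B {p : Fin 2 → ℝ | 0 ≤ p 0 ∧ 0 ≤ p 1 ∧ p 0 + p 1 ≤ 1} → (∀ p : Fin 2 → ℝ, 0 < p 0 → 0 < p 1 → p 0 + p 1 < 1 → HasFDerivAt S (A p • (ContinuousLinearMap.proj 0 : (Fin 2 → ℝ) →L[ℝ] ℝ) + B p • (ContinuousLinearMap.proj 1 : (Fin 2 → ℝ) →L[ℝ] ℝ)) p) → ∃ (k : ℕ) (x : Fin (k + 1) → ℝ) (m : ℕ) (str : Fin m → Fin k) (lev : Fin m → ℕ) (L : Fin k → ℕ) (lo hi : Fin m → ℝ → ℝ) (ε : Fin m → ℤ) (C : Fin m → Set (Fin 2 → ℝ)) (ρlo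 ρhi : Fin m → KZ.IntegralRep 1) (r₁ r₂ : Fin m → KZ.IntegralRep 2), StrictMono x ∧ x 0 = 0 ∧ x (Fin.last k) = 1 ∧ (∀ i, lev i < L (str i)) ∧ (∀ i j, str i = str j → lev i = lev j → i = j) ∧ (∀ (j : Fin k) (l : ℕ), l < L j → ∃ i, str i = j ∧ lev i = l) ∧ (∀ j, 0 < L j) ∧ (∀ i, lev i = 0 → ∀ t ∈ (Set.Icc (x (Fin.castSucc (str i))) (x (Fin.succ (str i)))), lo i t = 0) ∧ (∀ i, lev i + 1 = L (str i) → ∀ t ∈ (Set.Icc (x (Fin.castSucc (str i))) (x (Fin.succ (str i)))), hi i t = 1 - t) ∧ (∀ i j, str i = str j → lev j = lev i + 1 → ∀ t ∈ (Set.Icc (x (Fin.castSucc (str i))) (x (Fin.succ (str i)))), lo j t = hi i t) ∧ (∀ i, ContinuousOn (lo i) (Set.Icc (x (Fin.castSucc (str i))) (x (Fin.succ (str i))))) ∧ (∀ i, ContinuousOn (hi i) (Set.Icc (x (Fin.castSucc (str i))) (x (Fin.succ (str i))))) ∧ (∀ i, MonotoneOn (lo i) (Set.Icc (x (Fin.castSucc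 (str i))) (x (Fin.succ (str i)))) ∨ AntitoneOn (lo i) (Set.Icc (x (Fin.castSucc (str i))) (x (Fin.succ (str i))))) ∧ (∀ i, MonotoneOn (hi i) (Set.Icc (x (Fin.castSucc (str i))) (x (Fin.succ (str i)))) ∨ AntitoneOn (hi i) (Set.Icc (x (Fin.castSucc (str i))) (x (Fin.succ (str i))))) ∧ (∀ i, ∀ t ∈ (Set.Ioo (x (Fin.castSucc (str i))) (x (Fin.succ (str i)))), lo i t < hi i t) ∧ (∀ i, IsSemialgebraicFunOn ℚ {z : Fin 1 → ℝ | z 0 ∈ Set.Ioo (x (Fin.castSucc (str i))) (x (Fin.succ (str i)))} (fun z => lo i (z 0))) ∧ (∀ i, IsSemialgebraicFunOn ℚ {z : Fin 1 → ℝ | z 0 ∈ Set.Ioo (x (Fin.castSucc (str i))) (x (Fin.succ (str i)))} (fun z => hi i (z 0))) ∧ (∀ i, C i = {p : Fin 2 → ℝ | p 0 ∈ (Set.Ioo (x (Fin.castSucc (str i))) (x (Fin.succ (str i)))) ∧ lo i (p 0) < p 1 ∧ p 1 < hi i (p 0)}) ∧ (∀ i, IsOpen (C i)) ∧ (∀ i,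 IsSemialgebraic ℚ (C i)) ∧ (∀ i, C i ⊆ {p : Fin 2 → ℝ | 0 < p 0 ∧ 0 < p 1 ∧ p 0 + p 1 < 1}) ∧ (Pairwise fun i j => Disjoint (C i) (C j)) ∧ MeasureTheory.volume ({p : Fin 2 → ℝ | 0 < p 0 ∧ 0 < p 1 ∧ p 0 + p 1 < 1} \ ⋃ i, C i) = 0 ∧ (∀ i, ContDiffOn ℝ 1 A (C i)) ∧ (∀ i, ContDiffOn ℝ 1 B (C i)) ∧ (∀ i, ∀ p ∈ C i, fderiv ℝ A p (Pi.single 1 1) = fderiv ℝ B p (Pi.single 0 1)) ∧ (∀ i, ε i = 1 ∨ ε i = -1 ∨ ε i = 0) ∧ (∀ i, ∀ p ∈ C i, ε i ≠ 0 → 0 < (ε i : ℝ) * fderiv ℝ A p (Pi.single 1 1)) ∧ (∀ i, ∀ p ∈ C i, ε i = 0 → fderiv ℝ A p (Pi.single 1 1) = 0) ∧ (∀ i, ε i ≠ 0 → Set.InjOn (fun p : Fin 2 → ℝ => (![p 0, A p] : Fin 2 → ℝ)) (C i)) ∧ (∀ i, ε i ≠ 0 → Set.InjOn (fun p : Fin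 2 → ℝ => (![p 1, B p] : Fin 2 → ℝ)) (C i)) ∧ (∀ i, (ρlo i).domain = {z : Fin 1 → ℝ | z 0 ∈ Set.Ioo (x (Fin.castSucc (str i))) (x (Fin.succ (str i)))}) ∧ (∀ i, (ρhi i).domain = {z : Fin 1 → ℝ | z 0 ∈ Set.Ioo (x (Fin.castSucc (str i))) (x (Fin.succ (str i)))}) ∧ (∀ i, ∀ z ∈ (ρlo i).domain, (ρlo i).integrand z = A ![z 0, lo i (z 0)]) ∧ (∀ i, ∀ z ∈ (ρhi i).domain, (ρhi i).integrand z = A ![z 0, hi i (z 0)]) ∧ (∀ i, (r₁ i).domain = (fun p : Fin 2 → ℝ => (![p 0, A p] : Fin 2 → ℝ)) '' C i) ∧ (∀ i, (r₂ i).domain = (fun p : Fin 2 → ℝ => (![p 1, B p] : Fin 2 → ℝ)) '' C i) ∧ (∀ i, (r₁ i).integrand = fun _ => 1) ∧ (∀ i, (r₂ i).integrand = fun _ => 1)) → ∀ (A B S : (Fin 2 → ℝ) → ℝ), IsSemialgebraicFunOn ℚ {p : Fin 2 → ℝ | 0 ≤ p 0 ∧ 0 ≤ p 1 ∧ p 0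 + p 1 ≤ 1} A → IsSemialgebraicFunOn ℚ {p : Fin 2 → ℝ | 0 ≤ p 0 ∧ 0 ≤ p 1 ∧ p 0 + p 1 ≤ 1} B → ContinuousOn A {p : Fin 2 → ℝ | 0 ≤ p 0 ∧ 0 ≤ p 1 ∧ p 0 + p 1 ≤ 1} → ContinuousOn B {p : Fin 2 → ℝ | 0 ≤ p 0 ∧ 0 ≤ p 1 ∧ p 0 + p 1 ≤ 1} → (∀ p : Fin 2 → ℝ, 0 < p 0 → 0 < p 1 → p 0 + p 1 < 1 → HasFDerivAt S (A p • (ContinuousLinearMap.proj 0 : (Fin 2 → ℝ) →L[ℝ] ℝ) + B p • (ContinuousLinearMap.proj 1 : (Fin 2 → ℝ) →L[ℝ] ℝ)) p) → ∀ (r₀₁ r₁₂ r₀₂ : KZ.IntegralRep 1), r₀₁.domain = {z : Fin 1 → ℝ | z 0 ∈ Set.Ioo 0 1} → r₁₂.domain = {z : Fin 1 → ℝ | z 0 ∈ Set.Ioo 0 1} → r₀₂.domain = {z : Fin 1 → ℝ | z 0 ∈ Set.Ioo 0 1} → (∀ z ∈ r₀₁.domain, r₀₁.integrand z = A ![z 0,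 0]) → (∀ z ∈ r₁₂.domain, r₁₂.integrand z = B ![1 - z 0, z 0] - A ![1 - z 0, z 0]) → (∀ z ∈ r₀₂.domain, r₀₂.integrand z = B ![0, z 0]) → Θ (KZ.of r₀₁ + KZ.of r₁₂ - KZ.of r₀₂) ∈ AddSubgroup.closure ((KZ.domainAddRel ∪ KZ.changeOfVariablesRel) ∩ (AddSubgroup.closure {x : KZ.FormalRep | ∃ s : KZ.IntegralRep 2, (∀ p ∈ s.domain, s.integrand p = 1) ∧ x = KZ.of s} : Set KZ.FormalRep)) := by
  sorry


/-- **The compiler.** `RealOnePeriodRelations → PlanarK0Injective`: normalise both regions to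
`Θ`-images of 1-dimensional combinations `c, c'` (stub 2), feed the vanishing combination `c − c'`
to the antecedent, and push the resulting certificate through `Θ` by closure induction — the
elementary moves by stub 3, the Green generator by stubs 4–7. -/
theorem PlanarCompiler_of : PlanarCompiler := by
  intro hR r r' hr hr' hval
  obtain ⟨Θ, hΘ⟩ := stub_cellCompiler
  have hmoves := stub_elementaryMoves Θ hΘ
  obtain ⟨c, hc, hce, hcr⟩ := stub_normalForm Θ hΘ r hr
  obtain ⟨c', hc', hce', hcr'⟩ := stub_normalForm Θ hΘ r' hr'
  have hcc' : c - c' ∈ AddSubgroup.closure (Set.range fun ρ : KZ.IntegralRep 1 => KZ.of ρ) :=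
    sub_mem hc hc'
  have heval : KZ.eval (c - c') = 0 := by rw [map_sub, hce, hce', hval, sub_self]
  have hgen := hR (c - c') hcc' heval
  have hΘG : Θ (c - c') ∈ AddSubgroup.closure ((KZ.domainAddRel ∪ KZ.changeOfVariablesRel) ∩ (AddSubgroup.closure {x : KZ.FormalRep | ∃ s : KZ.IntegralRep 2, (∀ p ∈ s.domain, s.integrand p = 1) ∧ x = KZ.of s} : Set KZ.FormalRep)) := by
    refine AddSubgroup.closure_induction (fun x hx => ?_) ?_ (fun x y _ _ hx hy => ?_)
      (fun x _ hx => ?_) hgen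
    · rcases hx with hx | hx
      · exact hmoves x hx
      · obtain ⟨Δ', A, B, S, r₀₁, r₁₂, r₀₂, hΔ, hA, hB, hAc, hBc, hS, h1, h2, h3, h4, h5, h6, rfl⟩ := hx
        subst hΔ
        exact stub_greenAssembly Θ hΘ hmoves stub_shearedTransport stub_band stub_signedSweep A B S hA hB
          hAc hBc hS r₀₁ r₁₂ r₀₂ h1 h2 h3 h4 h5 h6
    · simp only [map_zero]; exact zero_mem _
    · simp only [map_add]; exact add_mem hx hy
    · simp only [map_neg]; exact neg_mem hx
  have hsplit : KZ.of r - KZ.of r' = (KZ.of r - Θ c) + Θ (c - c') - (KZ.of r' - Θ c') := by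
    rw [map_sub]; abel
  rw [hsplit]
  exact sub_mem (add_mem hcr hΘG) hcr'

end Summit.KontsevichZagierPeriods.SymplecticScissors.PlanarCompilerProof
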